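import Summits.BirchSwinnertonDyer.Rank1Residual.X11b.RouteR1IMCEqIntCoreFrame
import Summits.BirchSwinnertonDyer.Rank1Residual.X11b.RouteR1IntReceptacleOneSided
import Summits.BirchSwinnertonDyer.Rank1Residual.X11b.RouteR1IntFrame
import Summits.BirchSwinnertonDyer.Rank1Residual.X11b.RouteR1BaseSelmerCount
import Summits.BirchSwinnertonDyer.Rank1Residual.X11b.RouteP2OpenInputFromPrint
import Summits.BirchSwinnertonDyer.Rank1Residual.X11b.BDPRouteSelmerFiniteRankOne
import Summits.BirchSwinnertonDyer.Rank1Residual.X11b.BDPRouteControlTorsion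
import Summits.BirchSwinnertonDyer.Rank1Residual.X11b.BDPRouteControlUpper
import Summits.BirchSwinnertonDyer.Rank1Residual.X11b.AnticyclotomicTamagawa
import HarnessLib

/-!
# Class X11b, route p2's ONE-SIDED method AT ROUTE R1's ERRATUM FIELDS (`p ≥ 5`): the typed input
# "(2.4)♭ for SOME ♭-frame at the erratum data" — the DIVISIBILITY, not the equality —, the
# one-sided control there as a THEOREM, route p2's pointwise open input and the `≥`-half of
# Castella's display (5.3) at erratum data (cell `b2b-bsdres`, sub-cell `multr1-p2`, gen 28; file 3)

HONEST FRAMING (cell `b2b-bsdres`, run/shared/lean/b2b/bsd-rank1-residual/, verbatim in every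
file): the goal of the cell is to DELETE the COMBINATION-SHAPED residual classes of the
Birch–Swinnerton-Dyer formula for ALL analytic-rank `≤ 1` elliptic curves over `ℚ` — "full BSD
formula for every rank `≤ 1` curve in class `C`" assembled STRICTLY from published theorems — so
that the rank-`≤ 1` remainder becomes exactly the CONSTRUCTION-SHAPED classes, which are TYPED
(missing-input `Prop`s), NOT attempted. This is not "finishing BSD". Sub-cell `multr1-p2` is a
RESEARCH ROUTE on class X11b (`ClassX11b W p := r_an = 1 ∧ p ≠ 2 ∧ mult(p) ∧ irr(p)`); no claim
beyond the stated class and loci; X11b's label does not change; NOTHING is booked by this file.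

TWO `Prop`-valued SHAPES with bodies (OPEN, claim-tagged, NEVER theorems; the one-sided twins of
route R1's `R1.IMCEqIntFrameOnTree` / `R1.IMCEqIntCoreFrameOnTree`, binders VERBATIM) and theorems;
no named fact; no `sorry`. Namespace treaty: the `R1.` shapes and every-p lemmas of multr1-p1 and
team x11b3's `Three.` files are IMPORTED, never restated.

## Why (the finding of gen 28)

Route p2's open statement (2.4)∃♭ (`P2.IMCDivSomeFrameOnTree[AtField]`, gens 25–27) is asked at the
route's CLASSICAL Heegner data — `K` imaginary quadratic with EVERY `ℓ ∣ N_E` SPLIT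
(`SatisfiesHeegnerHypothesis`). But the only announced derivation of (2.4) at `p ∥ N` — the
erratum's Thm. 2.3 "By [FW21, Thm. 4.41], we then have the divisibility (2.4)" — carries
Fouquet–Wan's hypothesis "there is `q ∥ N` NOT split in `K`" (with `E` non-split multiplicative and
`E[p]` ramified at such a `q`: hypothesis (iii) of erratum Thm. 1.1, Castella arXiv:2409.01360 §2.1;
cell FRESHNESS row on arXiv:2107.13726), i.e. it lives at the ERRATUM FIELDS of route R1 (`q`
ramified in `K`), not at classical fields; and it is ONE divisibility, the EQUALITY of erratum Thm.
1.1 needing in addition [Cas20, Thm. 2.11] and the limiting argument. So in the cell: route R1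
(multr1-p1) asks the EQUALITY at erratum fields; route p2 asks the DIVISIBILITY at classical fields
(no announced derivation under (iii)); team x11b3's LINE W≥ (`Three/RouteR1Lower.lean`) types the
`≥`-half of the display (5.3) at erratum fields at `p = 3` as a display-level binder. NOBODY asked
the divisibility at erratum fields at `p ≥ 5` — the weakest statement with an announced derivation.
This file and its sequel do: route p2's one-sided METHOD (lower half from the divisibility, upper
half from Kolyvagin at a classical field) run at route R1's FIELDS.

## What this file proves

* §1 shapes **`P2.IMCDivIntFrameAtErratumData W p`** (at every datum of `R1.IMCEqIntFrameOnTree`: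
  a ♭-frame with Castella's interpolation property, the value at `𝟙` AND THE DIVISIBILITY
  `Ch_Λ(X_ac^∅(E[p^∞]))·𝓞_{ℂ_p}⟦T⟧ ⊆ (Q)`) and **`P2.IMCDivIntCoreFrameAtErratumData W p`** (no value).
* §2 bridges: R1's equality shapes imply them (`le_of_eq`); with-value ⟹ core; on SEMISTABLE pairs
  core ⟹ with-value (`h32` + multr1-p2's ♭-V1RIG, exactly as multr1-p1's
  `R1.imcEqIntFrameOnTree_of_thm32_of_imcEqIntCoreFrame`).
* §3 **`controlUpperOnTreeAt_of_isErratumField`** — (CTL≤)ᵗ AT AN ERRATUM DATUM is a THEOREM modulo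
  GZK, modularity and the cited PT/EP (gen 19's rank-one torsion-weighted Selmer bound + gen 17's
  control-from-bound; rank one and finite `Ш(E/K)` by multr1-p1's
  `IsErratumField.mordellWeilRank_eq_one_and_shaFinite`); NO (iv), NO Heegner hypothesis.
* §4 **`imcLowerWaldspurgerOnTreeAt_of_imcDivIntFrameAtErratumData`** — route p2's POINTWISE open
  input `(IMC≥∘BDP)ᵗ` at every erratum datum and every `(κ, γ, 𝔭)` from the with-value shape (CTL₀
  from §3; multr1-p1's one-sided assembly `R1.imcLowerWaldspurgerOnTreeAt_of_intValue_of_intDvd` and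
  embedding bookkeeping); **`display53Lower_of_imcDivIntFrameAtErratumData`** — the `≥`-HALF (A≥) of
  Castella's display (5.3), `2·ord_p[E(K):ℤP] − ord_p ∏_w c_w(E/K) ≤ ord_p #Ш(E/K)[p^∞]`, at every
  erratum datum: x11b3's typed binder (A≥|VoR) of LINE W≥, DERIVED at `p ≥ 5` from (2.4)♭.

CONDITIONAL on the one-sided shape (PREPRINT-derived); nothing booked; labels UNCHANGED; X11b stays
CONSTRUCTION-SHAPED. Credits: multr1-p1 (`R1.`/erratum infrastructure, ♭-assembly), x11b3 (LINE W≥).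

References: [Castella2018Erratum] (2.4), Thm. 2.3, Thm. 1.1 (p. 4); [Castella2018] Thms. 2.3,
3.1, 3.2, §5; [FouquetWan2021] arXiv:2107.13726 Thm. 4.41 (PREPRINT); Castella arXiv:2409.01360 §2.1
(iii) (PREPRINT); [JetchevSkinnerWan2017] §7.4.1; [MilneADT2006] I.4.10(b), I.2.8; [GreenbergLNM1716] L.3.3.
-/

noncomputable section

open scoped Classical

open WeierstrassCurve NumberField IsDedekindDomain Field PowerSeries
open Literature.NumberTheory.EllipticCurves Literature.NumberTheory.EllipticCurves.GreenbergSelmer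
open Literature.NumberTheory.EllipticCurves.ModularForms
open Literature.NumberTheory.EllipticCurves.Rank1Residual
open Literature.NumberTheory.EllipticCurves.Rank1Residual.Typed
open Literature.NumberTheory.EllipticCurves.Castella2018
open Literature.NumberTheory.GaloisRepresentations
open Literature.NumberTheory.GaloisCohomology
open Summit.BirchSwinnertonDyer.Rank1Residual.X11b.AcSelmer
open Summit.BirchSwinnertonDyer.Rank1Residual.X11b.Halves

namespace Summit.BirchSwinnertonDyer.Rank1Residual.X11b

/-! ### §1 The shapes -/

section Shape

variable (W : WeierstrassCurve ℚ) [W.IsElliptic] [W.IsGloballyMinimal] (p : ℕ) [Fact p.Prime]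

/-- **(2.4)♭ ONE-SIDED, WITH VALUE, AT ROUTE R1's ERRATUM DATA (OPEN shape)** — the one-sided
twin of multr1-p1's `R1.IMCEqIntFrameOnTree` (binders VERBATIM): at every such datum THERE IS a
♭-frame `(Ω_K ≠ 0, ‖Ω_p‖ = 1, Q ∈ 𝓞_{ℂ_p}⟦T⟧)` with Castella's interpolation property [Cas18 Thm.
3.1, receptacle widened], the value `Q(𝟙) = u·((1 − a_p(E) p⁻¹)·log_{ω_E} P)²`, `‖u‖ = 1` [Cas18
Thm. 3.2] and the DIVISIBILITY `Ch_Λ(X_ac^∅(E[p^∞]))·𝓞_{ℂ_p}⟦T⟧ ⊆ (Q)` [erratum (2.4) ⇐ erratum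
Thm. 2.3 ⇐ [FW21, Thm. 4.41] (one divisibility; "∃ q ∥ N not split in K") + Hida descent —
PREPRINT]. Weaker than R1's H3∃♭ (equality). A predicate on `(W, p)`; NEVER a theorem in this cell;
every result using it is CONDITIONAL. [claim: Castella2018Erratum, status: under-review]
[cite: Castella2018, Thm. 3.1, display (3.2) and Thm. 3.2 (arXiv:1704.06608 p. 9) (shape only; nothing asserted)]
[cite: Hsieh2014, p. 7 (arXiv:1112.1580) (the receptacle `Z̄_p⟦Γ⁻⟧ ⊆ 𝓞_{ℂ_p}⟦T⟧`)] -/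
def P2.IMCDivIntFrameAtErratumData : Prop :=
  ∀ [NeZero (W.conductorNorm ℤ)] (q : ℕ) [Fact q.Prime] (K : Type) [Field K] [NumberField K]
    (Dt : ModularParametrizationData W (W.conductorNorm ℤ))
    (H : HeegnerDatum (W.conductorNorm ℤ) (NumberField.discr K)) (w₀ : InfinitePlace K)
    (P : (W.baseChange K).toAffine.Point), ErratumHypotheses W p → W.analyticRank = 1 →
    q ≠ p → Mult W q → ¬ W.HasSplitMultiplicativeReductionAtPrime q →
    ¬ p ∣ padicValInt q W.minimalDiscriminantInt → IsErratumField W K q →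
    Cas20Standing K p (W.conductorNorm ℤ / p) →
    WeierstrassCurve.Affine.Point.map w₀.embedding.toRatAlgHom P = heegnerPointComplex Dt H →
    ¬ (p : ℤ) ∣ Dt.c → ¬ IsOfFinAddOrder P →
    ∀ (κ : ZpExtension K p), κ.IsAnticyclotomic →
      ∀ (γ : Field.absoluteGaloisGroup K) [Fact (κ.IsTopGenerator γ)] (ι' : PadicAlgCl p ≃+* ℂ)
        (e : K →+* ℚ_[p]),
        (∀ k : 𝓞 K, k ∈ (primeOfEmbeddingDatum p ι' w₀.embedding).asIdeal ↔ ‖e (k : K)‖ < 1) →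
        ∃ (ΩK : ℂ) (Ωp : ℂ_[p]) (Q : PowerSeries 𝓞_ℂ_[p]), ΩK ≠ 0 ∧ ‖Ωp‖ = 1 ∧
          R1.IsBDPLFunctionInt p ι' (primeOfEmbeddingDatum p ι' w₀.embedding) κ γ Dt.f ΩK Ωp Q ∧
          R1.BDPValueAtOneIntAt W p e P Q (W.LFunction p) ∧
          (XAc.charIdeal (W.baseChange K) p κ (primeOfEmbeddingDatum p ι' w₀.embedding) ∅ γ).map
              (PowerSeries.map (R1.toCpInt p)) ≤ Ideal.span {Q}

/-- **(2.4)♭ ONE-SIDED, WITHOUT THE VALUE CONJUNCT, AT ROUTE R1's ERRATUM DATA (OPEN shape)** —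
the one-sided twin of multr1-p1's `R1.IMCEqIntCoreFrameOnTree`: per datum a ♭-frame with Castella's
interpolation property and the divisibility `Ch_Λ(X_ac^∅(E[p^∞]))·𝓞_{ℂ_p}⟦T⟧ ⊆ (Q)` [erratum (2.4)
⇐ [FW21, Thm. 4.41] + Hida descent, PREPRINT]; on SEMISTABLE pairs the value conjunct is supplied
from print (§2). A predicate on `(W, p)`; NEVER a theorem in this cell; every result using it is
CONDITIONAL. [claim: Castella2018Erratum, status: under-review]
[cite: Castella2018, Thm. 3.1 and display (3.2) (arXiv:1704.06608 p. 9) (shape only; nothing asserted)] -/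
def P2.IMCDivIntCoreFrameAtErratumData : Prop :=
  ∀ [NeZero (W.conductorNorm ℤ)] (q : ℕ) [Fact q.Prime] (K : Type) [Field K] [NumberField K]
    (Dt : ModularParametrizationData W (W.conductorNorm ℤ))
    (H : HeegnerDatum (W.conductorNorm ℤ) (NumberField.discr K)) (w₀ : InfinitePlace K)
    (P : (W.baseChange K).toAffine.Point), ErratumHypotheses W p → W.analyticRank = 1 →
    q ≠ p → Mult W q → ¬ W.HasSplitMultiplicativeReductionAtPrime q →
    ¬ p ∣ padicValInt q W.minimalDiscriminantInt → IsErratumField W K q →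
    Cas20Standing K p (W.conductorNorm ℤ / p) →
    WeierstrassCurve.Affine.Point.map w₀.embedding.toRatAlgHom P = heegnerPointComplex Dt H →
    ¬ (p : ℤ) ∣ Dt.c → ¬ IsOfFinAddOrder P →
    ∀ (κ : ZpExtension K p), κ.IsAnticyclotomic →
      ∀ (γ : Field.absoluteGaloisGroup K) [Fact (κ.IsTopGenerator γ)] (ι' : PadicAlgCl p ≃+* ℂ)
        (e : K →+* ℚ_[p]),
        (∀ k : 𝓞 K, k ∈ (primeOfEmbeddingDatum p ι' w₀.embedding).asIdeal ↔ ‖e (k : K)‖ < 1) →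
        ∃ (ΩK : ℂ) (Ωp : ℂ_[p]) (Q : PowerSeries 𝓞_ℂ_[p]), ΩK ≠ 0 ∧ ‖Ωp‖ = 1 ∧
          R1.IsBDPLFunctionInt p ι' (primeOfEmbeddingDatum p ι' w₀.embedding) κ γ Dt.f ΩK Ωp Q ∧
          (XAc.charIdeal (W.baseChange K) p κ (primeOfEmbeddingDatum p ι' w₀.embedding) ∅ γ).map
              (PowerSeries.map (R1.toCpInt p)) ≤ Ideal.span {Q}

end Shape

/-! ### §2 Bridges between the shapes -/

section Bridges

variable {W : WeierstrassCurve ℚ} [W.IsElliptic] [W.IsGloballyMinimal] {p : ℕ} [Fact p.Prime]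

/-- R1's EQUALITY shape H3∃♭ implies the one-sided shape (`le_of_eq`).
[claim: Castella2018Erratum, status: under-review] -/
theorem P2.imcDivIntFrameAtErratumData_of_imcEqIntFrame (h3 : R1.IMCEqIntFrameOnTree W p) :
    P2.IMCDivIntFrameAtErratumData W p := by
  intro _ q _ K _ _ Dt H w₀ P hE hr hqp hmq hns hvq hK hCas hP hc hinf κ hκ γ _ ι' e he
  obtain ⟨ΩK, Ωp, Q, hΩ, hΩp, hQ, h2, h3At⟩ :=
    h3 q K Dt H w₀ P hE hr hqp hmq hns hvq hK hCas hP hc hinf κ hκ γ ι' e he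
  exact ⟨ΩK, Ωp, Q, hΩ, hΩp, hQ, h2, le_of_eq h3At⟩

omit [W.IsElliptic] in
/-- R1's EQUALITY core shape H3∃♭⁻ implies the one-sided core shape.
[claim: Castella2018Erratum, status: under-review] -/
theorem P2.imcDivIntCoreFrameAtErratumData_of_imcEqIntCoreFrame
    (h3 : R1.IMCEqIntCoreFrameOnTree W p) : P2.IMCDivIntCoreFrameAtErratumData W p := by
  intro _ q _ K _ _ Dt H w₀ P hE hr hqp hmq hns hvq hK hCas hP hc hinf κ hκ γ _ ι' e he
  obtain ⟨ΩK, Ωp, Q, hΩ, hΩp, hQ, h3At⟩ :=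
    h3 q K Dt H w₀ P hE hr hqp hmq hns hvq hK hCas hP hc hinf κ hκ γ ι' e he
  exact ⟨ΩK, Ωp, Q, hΩ, hΩp, hQ, le_of_eq h3At⟩

/-- Forget the value conjunct. [claim: Castella2018Erratum, status: under-review] -/
theorem P2.imcDivIntCoreFrameAtErratumData_of_imcDivIntFrame
    (h : P2.IMCDivIntFrameAtErratumData W p) : P2.IMCDivIntCoreFrameAtErratumData W p := by
  intro _ q _ K _ _ Dt H w₀ P hE hr hqp hmq hns hvq hK hCas hP hc hinf κ hκ γ _ ι' e he
  obtain ⟨ΩK, Ωp, Q, hΩ, hΩp, hQ, -, h3At⟩ :=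
    h q K Dt H w₀ P hE hr hqp hmq hns hvq hK hCas hP hc hinf κ hκ γ ι' e he
  exact ⟨ΩK, Ωp, Q, hΩ, hΩp, hQ, h3At⟩

/-- On a SEMISTABLE pair the value conjunct comes from print (Cas18 Thms. 3.1–3.2, `h32`) at ANY
♭-frame (♭-V1RIG across periods): core shape ⟹ shape with value.
[cite: Castella2018, Thm. 3.1, display (3.2) and Thm. 3.2 (arXiv:1704.06608 p. 9)] -/
theorem P2.imcDivIntFrameAtErratumData_of_thm32_of_core
    (h32 : thm32_exists_isBDPLFunction_valueAtOne) (hss : Semistable W)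
    (h : P2.IMCDivIntCoreFrameAtErratumData W p) : P2.IMCDivIntFrameAtErratumData W p := by
  intro _ q _ K _ _ Dt H w₀ P hE hr hqp hmq hns hvq hK hCas hP hc hinf κ hκ γ _ ι' e he
  obtain ⟨ΩK, Ωp, Q, hΩ, hΩp, hQ, h3At⟩ :=
    h q K Dt H w₀ P hE hr hqp hmq hns hvq hK hCas hP hc hinf κ hκ γ ι' e he
  obtain ⟨ΩK', Ωp', L', hΩ', hL', h2'⟩ :=
    R1.exists_frame_bdpValueAtOneOnTreeAt_of_thm32 h32 ι' Dt H hE hss hqp hK hc w₀ hP κ hκ γ he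
  have hp2 : p ≠ 2 := hE.two_ne
  have hΩp0 : Ωp ≠ 0 := by
    intro h0
    rw [h0, norm_zero] at hΩp
    exact zero_ne_one hΩp
  have hΩp'0 : ((Ωp' : unrIntegers p) : ℂ_[p]) ≠ 0 := by
    rw [Ne, ZeroMemClass.coe_eq_zero]
    exact Units.ne_zero Ωp'
  exact ⟨ΩK, Ωp, Q, hΩ, hΩp, hQ,
    R1.bdpValueAtOneIntAt_of_isBDPLFunctionInt hp2 hK.1 hκ hΩ hΩ' hΩp0 hΩp'0 hQ
      (R1.isBDPLFunctionInt_map hL') (R1.bdpValueAtOneIntAt_map h2'), h3At⟩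

end Bridges

/-! ### §3 The one-sided control at erratum data (theorem) -/

section Control

variable {W : WeierstrassCurve ℚ} [W.IsElliptic] [W.IsGloballyMinimal] {p : ℕ} [Fact p.Prime]
  {K : Type} [Field K] [NumberField K]

/-- **(CTL≤)ᵗ AT AN ERRATUM DATUM from published + cited facts.** For `W/ℚ` globally minimal
elliptic with `ord_{s=1} L(E,s) = 1`, `p` multiplicative with `E[p]` irreducible, an erratum field
`K` for a prime `q ≠ p` (imaginary quadratic, `L(E^{d_K},1) ≠ 0`; `p` splits since `p ∣ N_E`,
`p ≠ q`), a point `P ∈ E(K)` of infinite order, an anticyclotomic `κ` with generator `γ` and a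
degree-one prime `𝔭 ∋ p` of `K`: `ControlUpperOnTreeAt p κ 𝔭 γ (embAt K p 𝔭) P`. Rank one and
finiteness of `Ш(E/K)` from GZK over `ℚ` (`IsErratumField.mordellWeilRank_eq_one_and_shaFinite`,
multr1-p1); the torsion-weighted Selmer bound `selmerCardBoundTorsion_of_rankOne_primary` (gen 19:
Poitou–Tate + local Euler characteristic) fed to gen 17's `controlUpperOnTreeAt_of_selmerCardBound_torsion`.
NO Heegner hypothesis, NO (iv). [cite: Castella2018, Thm. 2.3 and its proof (arXiv:1704.06608 pp. 5–6)]
[cite: MilneADT2006, Ch. I, Thm. 4.10(b) and Thm. 2.8] [cite: GreenbergLNM1716, §3 Lemma 3.3 (p. 87)] -/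
theorem controlUpperOnTreeAt_of_isErratumField
    (hGZK : rank_eq_analyticRank_of_analyticRank_le_one) (hnf : exists_isNewformOf)
    (hPT : ∀ (K : Type) [Field K] [NumberField K], poitouTate_sum_localTatePairing_eq_zero K)
    (hEP : ∀ (K : Type) [Field K] [NumberField K] (v : HeightOneSpectrum (𝓞 K)),
      localEulerPoincareCharacteristic (v.adicCompletion K))
    (hr : W.analyticRank = 1) (hmult : Mult W p) (hirr : Irr W p) {q : ℕ} [Fact q.Prime]
    (hqp : q ≠ p) (hKf : IsErratumField W K q)
    {P : (W.baseChange K).toAffine.Point} (hPinf : ¬ IsOfFinAddOrder P)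
    {κ : ZpExtension K p} (hκ : κ.IsAnticyclotomic) (γ : Field.absoluteGaloisGroup K)
    [Fact (κ.IsTopGenerator γ)]
    (𝔭 : HeightOneSpectrum (𝓞 K)) (h𝔭 : ((p : ℕ) : 𝓞 K) ∈ 𝔭.asIdeal)
    (he : 𝔭.asIdeal.ramificationIdx (𝓞 ℚ) = 1) (hf : 𝔭.asIdeal.inertiaDeg (𝓞 ℚ) = 1) :
    ControlUpperOnTreeAt p κ 𝔭 γ (embAt K p 𝔭 h𝔭 he hf) P := by
  haveI : IsTotallyComplex K := hKf.1.2
  have hpN : p ∣ W.conductorNorm ℤ := dvd_conductorNorm_of_mult hmult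
  have hsplit : SplitsIn K p := hKf.splitsIn_of_mult hmult (Ne.symm hqp)
  obtain ⟨hrank, hSha⟩ := IsErratumField.mordellWeilRank_eq_one_and_shaFinite W hGZK hnf hr hKf
  haveI : Finite (W.baseChange K).sha := hSha
  have hShap : Finite (AddCommGroup.primaryComponent (W.baseChange K).sha p) :=
    Finite.of_injective _ Subtype.val_injective
  obtain ⟨hfin, a, ha, hm⟩ := selmerCardBoundTorsion_of_rankOne_primary W p K (hPT K) (hEP K)
    hmult hirr hKf.1 hsplit hrank hShap P hPinf 𝔭 h𝔭 he hf
  haveI := hfin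
  exact controlUpperOnTreeAt_of_selmerCardBound_torsion hKf.1.1 hκ h𝔭 he hf hsplit hpN ha hm

end Control

/-! ### §4 Route p2's pointwise open input at erratum data from the one-sided shape -/

section Pointwise

variable {W : WeierstrassCurve ℚ} [W.IsElliptic] [W.IsGloballyMinimal] {p : ℕ} [Fact p.Prime]
  {K : Type} [Field K] [NumberField K]

/-- **Route p2's POINTWISE open input `(IMC≥∘BDP)ᵗ` AT AN ERRATUM DATUM from the one-sided shape.**
For `(W, p)` on the A′-hypotheses with `ord_{s=1} L(E,s) = 1`, a non-split multiplicative `q ≠ p`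
with `E[p]` ramified, an erratum field `K` for `q` ([Cas20, §2.5] standing hypotheses at the tame
level), a Manin-good datum `Dt`, a Heegner point `P` of infinite order read through ANY complex
embedding `ιK` of `K`, an anticyclotomic `κ` with generator `γ` and a degree-one `𝔭 ∋ p`:
`IMCLowerWaldspurgerOnTreeAt p κ 𝔭 γ (embAt K p 𝔭) P`, from `P2.IMCDivIntFrameAtErratumData W p`,
the one-sided control (§3: CTL₀ comes with it) and multr1-p1's one-sided assembly over
`𝓞_{ℂ_p}⟦T⟧` (`R1.imcLowerWaldspurgerOnTreeAt_of_intValue_of_intDvd`). The embedding bookkeeping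
(`𝔭 = 𝔭_{ι'}` for `ι' ∈ {ι, ι ∘ conj}`; the datum's embedding is `w₀.embedding ∘ τ`, `τ ∈ Gal(K/ℚ)`;
`ord_p log(τ_* P) = ord_p log P` at rank one) is multr1-p1's (`R1.openInputOnTreeAt_of_imcEqIntFrame`)
VERBATIM. CONDITIONAL on the one-sided shape (OPEN).
[cite: Castella2018, Thms. 2.3, 3.1, 3.2 and §5 (arXiv:1704.06608 pp. 5, 9, 12)] [cite: Castella2018Erratum, (2.4) (p. 4)] -/
theorem imcLowerWaldspurgerOnTreeAt_of_imcDivIntFrameAtErratumData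
    (hGZK : rank_eq_analyticRank_of_analyticRank_le_one) (hnf : exists_isNewformOf)
    (hPT : ∀ (K : Type) [Field K] [NumberField K], poitouTate_sum_localTatePairing_eq_zero K)
    (hEP : ∀ (K : Type) [Field K] [NumberField K] (v : HeightOneSpectrum (𝓞 K)),
      localEulerPoincareCharacteristic (v.adicCompletion K))
    (ι : PadicAlgCl p ≃+* ℂ) (hD : P2.IMCDivIntFrameAtErratumData W p)
    [NeZero (W.conductorNorm ℤ)] {q : ℕ} [Fact q.Prime]
    (Dt : ModularParametrizationData W (W.conductorNorm ℤ))
    (H : HeegnerDatum (W.conductorNorm ℤ) (NumberField.discr K)) (ιK : K →+* ℂ)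
    {P : (W.baseChange K).toAffine.Point} (hE : ErratumHypotheses W p) (hr : W.analyticRank = 1)
    (hqp : q ≠ p) (hmq : Mult W q) (hns : ¬ W.HasSplitMultiplicativeReductionAtPrime q)
    (hvq : ¬ p ∣ padicValInt q W.minimalDiscriminantInt) (hK : IsErratumField W K q)
    (hCas : Cas20Standing K p (W.conductorNorm ℤ / p))
    (hP : WeierstrassCurve.Affine.Point.map ιK.toRatAlgHom P = heegnerPointComplex Dt H)
    (hc : ¬ (p : ℤ) ∣ Dt.c) (hinf : ¬ IsOfFinAddOrder P)
    {κ : ZpExtension K p} (hκ : κ.IsAnticyclotomic) (γ : Field.absoluteGaloisGroup K)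
    [Fact (κ.IsTopGenerator γ)]
    (𝔭 : HeightOneSpectrum (𝓞 K)) (h𝔭 : ((p : ℕ) : 𝓞 K) ∈ 𝔭.asIdeal)
    (he : 𝔭.asIdeal.ramificationIdx (𝓞 ℚ) = 1) (hf : 𝔭.asIdeal.inertiaDeg (𝓞 ℚ) = 1) :
    IMCLowerWaldspurgerOnTreeAt p κ 𝔭 γ (embAt K p 𝔭 h𝔭 he hf) P := by
  -- the one-sided control at the datum supplies CTL₀
  obtain ⟨n, hn, -⟩ := controlUpperOnTreeAt_of_isErratumField hGZK hnf hPT hEP hr hE.2.1 hE.2.2.1 hqp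
    hK hinf hκ γ 𝔭 h𝔭 he hf
  obtain ⟨w₀⟩ := (inferInstance : Nonempty (InfinitePlace K))
  have hp2 : p ≠ 2 := hE.two_ne
  -- `rank_ℤ E(K) = 1` on the erratum field (Gross–Zagier–Kolyvagin over `ℚ`)
  have hrk : (W.baseChange K).mordellWeilRank = 1 :=
    (IsErratumField.mordellWeilRank_eq_one_and_shaFinite W hGZK hnf hr hK).1
  -- the datum's complex embedding is `w₀.embedding ∘ τ` for some `τ ∈ Gal(K/ℚ)`, `τ² = 1`
  haveI : IsGalois ℚ K := by
    haveI : Algebra.IsQuadraticExtension ℚ K := ⟨hK.1.1⟩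
    infer_instance
  obtain ⟨σ, hσ⟩ := ComplexEmbedding.exists_comp_symm_eq_of_comp_eq (k := ℚ) w₀.embedding ιK
    (by ext x; simp)
  set τ : K →+* K := ((σ.symm : K ≃ₐ[ℚ] K) : K →+* K) with hτdef
  have hτ : ∀ x, τ (τ x) = x := by
    intro x
    have hcard : Nat.card (K ≃ₐ[ℚ] K) = 2 := by rw [IsGalois.card_aut_eq_finrank, hK.1.1]
    have hsq : σ.symm * σ.symm = 1 := by
      have h := pow_card_eq_one' (G := K ≃ₐ[ℚ] K) (x := σ.symm)
      rwa [hcard, pow_two] at h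
    have := congrArg (fun g : K ≃ₐ[ℚ] K ↦ g x) hsq
    simpa [hτdef, AlgEquiv.mul_apply] using this
  -- the Galois conjugate `P' = τ_* P` is the Heegner point read through `w₀.embedding`
  set P' := WeierstrassCurve.Affine.Point.map τ.toRatAlgHom P with hP'def
  have hP' : WeierstrassCurve.Affine.Point.map w₀.embedding.toRatAlgHom P' =
      heegnerPointComplex Dt H := by
    rw [hP'def, WeierstrassCurve.Affine.Point.map_map]
    have hcomp : w₀.embedding.toRatAlgHom.comp τ.toRatAlgHom = ιK.toRatAlgHom := by
      apply AlgHom.ext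
      intro x
      have := RingHom.congr_fun hσ x
      simpa [hτdef] using this
    rw [hcomp]
    exact hP
  have hinf' : ¬ IsOfFinAddOrder P' := fun h ↦ hinf
    ((WeierstrassCurve.Affine.Point.map_injective (f := τ.toRatAlgHom)).isOfFinAddOrder_iff.mp
      (by simpa [hP'def] using h))
  have hlog : ∀ e : K →+* ℚ_[p], padicLogOrd W p e P' = padicLogOrd W p e P := fun e ↦
    R1.padicLogOrd_map_eq_of_rank_one W p e P hp2 τ hτ hrk hinf
  have hemb : ∀ k : 𝓞 K, k ∈ 𝔭.asIdeal ↔ ‖embAt K p 𝔭 h𝔭 he hf (k : K)‖ < 1 :=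
    mem_asIdeal_iff_norm_embAt_lt_one 𝔭 h𝔭 he hf
  -- every degree-one prime above `p` is induced by `ι` or by `ι ∘ conj`
  have key : ∀ ι' : PadicAlgCl p ≃+* ℂ, 𝔭 = primeOfEmbeddingDatum p ι' w₀.embedding →
      IMCLowerWaldspurgerOnTreeAt p κ 𝔭 γ (embAt K p 𝔭 h𝔭 he hf) P := by
    intro ι' h𝔭eq
    subst h𝔭eq
    obtain ⟨ΩK, Ωp, Q, -, -, -, ⟨u, hu, hval⟩, h3At⟩ :=
      hD q K Dt H w₀ P' hE hr hqp hmq hns hvq hK hCas hP' hc hinf' κ hκ γ ι' _ hemb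
    refine imcLowerWaldspurgerOnTreeAt_of_padicLogOrd_eq W p _ (hlog _) ?_
    exact R1.imcLowerWaldspurgerOnTreeAt_of_intValue_of_intDvd hn h3At (le_of_eq hu)
      (W.LFunction p) hval
  rcases eq_primeOfEmbeddingDatum_or_eq_trans_starRingAut p ι hK.1 w₀ h𝔭 with h | h
  · exact key ι h
  · exact key _ h

/-- **The `≥`-HALF of Castella's display (5.3) — (A≥) — AT AN ERRATUM DATUM from the one-sided
shape, `p ≥ 5`.** Same data as above: `2·ord_p[E(K):ℤP] − ord_p ∏_w c_w(E/K) ≤ ord_p #Ш(E/K)[p^∞]`,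
from the pointwise input (previous theorem) and the one-sided control (§3) at ONE anticyclotomic
`(κ, γ, 𝔭)` (global reciprocity; `p` splits), both inequalities on `ord_p f_ac(0)` cancelling
(`two_mul_index_le_of_onTreeUpperLinks`), and `ord_p ∏_{w∣N⁺} c_w = ord_p ∏_w c_w(E/K)` on an
erratum field ((TAM-q): `E[p]` ramified at the only non-split bad prime `q`). This is x11b3's open
binder (A≥|VoR) of `Three/RouteR1Lower.lean` at `p ≥ 5`, now DERIVED from (2.4)♭. CONDITIONAL on
the one-sided shape (OPEN). [cite: Castella2018, §5 (5.1)–(5.3) (arXiv:1704.06608 p. 12)]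
[cite: JetchevSkinnerWan2017, §7.4.1 (eq:shalowerK-1) (arXiv:1512.06894 p. 30)] -/
theorem display53Lower_of_imcDivIntFrameAtErratumData
    (hGZK : rank_eq_analyticRank_of_analyticRank_le_one) (hnf : exists_isNewformOf)
    (hPT : ∀ (K : Type) [Field K] [NumberField K], poitouTate_sum_localTatePairing_eq_zero K)
    (hEP : ∀ (K : Type) [Field K] [NumberField K] (v : HeightOneSpectrum (𝓞 K)),
      localEulerPoincareCharacteristic (v.adicCompletion K))
    (hD : P2.IMCDivIntFrameAtErratumData W p)
    [NeZero (W.conductorNorm ℤ)] {q : ℕ} [Fact q.Prime]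
    (Dt : ModularParametrizationData W (W.conductorNorm ℤ))
    (H : HeegnerDatum (W.conductorNorm ℤ) (NumberField.discr K)) (ιK : K →+* ℂ)
    {P : (W.baseChange K).toAffine.Point} (hE : ErratumHypotheses W p) (hr : W.analyticRank = 1)
    (hqp : q ≠ p) (hmq : Mult W q) (hns : ¬ W.HasSplitMultiplicativeReductionAtPrime q)
    (hvq : ¬ p ∣ padicValInt q W.minimalDiscriminantInt) (hK : IsErratumField W K q)
    (hCas : Cas20Standing K p (W.conductorNorm ℤ / p))
    (hP : WeierstrassCurve.Affine.Point.map ιK.toRatAlgHom P = heegnerPointComplex Dt H)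
    (hc : ¬ (p : ℤ) ∣ Dt.c) (hinf : ¬ IsOfFinAddOrder P) :
    2 * (padicValNat p (AddSubgroup.zmultiples P).index : ℤ) -
        padicValNat p (W.baseChange K).tamagawaProduct ≤
      (padicValNat p (Nat.card (AddCommGroup.primaryComponent (W.baseChange K).sha p)) : ℤ) := by
  obtain ⟨ι⟩ := PadicAlgCl.nonempty_ringEquiv_complex p
  have hsplit : SplitsIn K p := hK.splitsIn_of_mult hE.2.1 (Ne.symm hqp)
  obtain ⟨κ, γ, 𝔭, hκ, hγ, h𝔭⟩ := exists_anticyclotomic_generator_prime (p := p) hK.1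
  haveI : Fact (κ.IsTopGenerator γ) := ⟨hγ⟩
  obtain ⟨he, hf⟩ := degreeOne_of_splitsIn hK.1.1 hsplit h𝔭
  have hIW := imcLowerWaldspurgerOnTreeAt_of_imcDivIntFrameAtErratumData hGZK hnf hPT hEP ι hD Dt H
    ιK hE hr hqp hmq hns hvq hK hCas hP hc hinf hκ γ 𝔭 h𝔭 he hf
  have hCTL := controlUpperOnTreeAt_of_isErratumField hGZK hnf hPT hEP hr hE.2.1 hE.2.2.1 hqp hK
    hinf hκ γ 𝔭 h𝔭 he hf
  have h := two_mul_index_le_of_onTreeUpperLinks hIW hCTL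
  rw [padicValNat_tamagawaProductSplit_eq_of_isErratumField W p K hE.1 q hmq hvq hK] at h
  omega

end Pointwise

end Summit.BirchSwinnertonDyer.Rank1Residual.X11b

end
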